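import Literature.Computability.Complexity.MurrayWilliams2018NQPQuasi
import Literature.Computability.Complexity.MurrayWilliams2018Lemma13
import HarnessLib

/-!
# Murray–Williams 2018: the §1.1 form `MurrayWilliams2018_NQP_not_ACC` is equivalent to Theorem 1.3

`CircuitLowerBounds.lean` vendors two threshold-free forms of the main result of C. D. Murray,
R. R. Williams, *Circuit lower bounds for nondeterministic quasi-polytime: an easy witness lemma
for NP and NQP* (STOC 2018): the printed, `(k, d, m)`-indexed Theorem 1.3
`MurrayWilliams2018_NTIME_not_depth_ACC` (for all `k`, `d`, `m ≥ 2` some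
`L ∈ NTIME (n ^ (log₂ n)ᵉ)`, `e ≥ 1`, has no depth-`d` `AC⁰[m]` circuit families of size
`c · n^{(log₂ n)ᵏ} + c`) and the single-language form of §1.1 `MurrayWilliams2018_NQP_not_ACC`
(for every `k` ONE `L ∈ NQP` without such circuits for any `(d, m, c)`). This file PROVES that
the two named facts are EQUIVALENT (`MurrayWilliams2018_NQP_not_ACC_iff_NTIME_not_depth_ACC`),
so that a discharge of either one discharges the other (the headline
`MurrayWilliams2018_NQP_not_subset_ACC0` already follows from each:
`MurrayWilliams2018_NQP_not_ACC.not_subset_ACC0`, `MurrayWilliams2018_NQP_not_subset_ACC0_of_thm_1_3`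
in `MurrayWilliams2018NQP.lean`):

* `MurrayWilliams2018_NQP_not_ACC_of_NTIME_not_depth_ACC` — §1.1 from Thm. 1.3 ALONE, by the
  pinning of `MurrayWilliams2018NQPQuasi.lean` (`exists_level_pinned`, Williams 2014, Lemma 5.1:
  if every `NQP` language had some `AC⁰_d[m]` circuits of size `c · n^{(log₂ n)ᵏ} + c`, the
  circuits of the `P`-language `EvalLang` fix one `(d₀, m₀)` and hard-wiring descriptions puts
  all of `NQP` into depth `d₀ + 1` over `m₀` at one level `K`, where Thm. 1.3 at
  `(K, d₀ + 1, m₀)` provides a counterexample in `NTIME (n ^ (log₂ n)ᵉ) ⊆ NQP`). The earlier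
  reduction `MurrayWilliams2018_NQP_not_ACC_of_thm_1_2_acc` went through Thm. 1.2 and therefore
  carried the `ACC`-SAT algorithm of Thm. 5.1 as a second hypothesis; read against Thm. 1.3 no
  SAT hypothesis is needed.
* `MurrayWilliams2018_NTIME_not_depth_ACC_of_NQP_not_ACC` — Thm. 1.3 from §1.1, which needs the
  hard `NQP` language to sit in a level `NTIME (n ^ (log₂ n)ᵉ)`, `e ≥ 1`, i.e. the agreement of
  the two presentations of nondeterministic quasi-polynomial time:
  **`NQP_eq_iUnion_NTIME_pow_log_pow : NQP = ⋃ₑ NTIME (n ^ (log₂ n)^(e+1))`** (the source, §1: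
  "`NQP = NTIME[n^{log^{O(1)} n}]`"; the tree's `NQP` is `⋃ₖ NTIME (2 ^ (log₂ n)ᵏ)`). Its
  inclusion `⊇` is `NTIME_pow_log_pow_subset_NQP` (`QuasiPolyClock.lean`); `⊆` is
  `NTIME_two_pow_log_pow_subset_NTIME_pow_log_pow_succ : NTIME (2 ^ (log₂ n)ᵏ) ⊆
  NTIME (n ^ (log₂ n)^(k+1))`, proved here by transporting verifiers along a unary clock
  (`NTIME_subset_of_clocks`, `MurrayWilliams2018Lemma13.lean`). The level `2 ^ (log₂ n)ᵏ` is
  not time constructible in the tree's sense when `k ≤ 1` (`IsTimeConstructible` asks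
  `n ≤ t n`), so the clock is built from plain time-computability:
  `exists_unaryClock_of_timeComputable` (the pipeline of `exists_unaryClock_of_timeConstructible`,
  `NTIMEHierarchyClock.lean`, with the running time kept symbolic) applied to the `FP` budget
  `1ⁿ ↦ bin (c · 2^{(log₂ n)ᵏ} + c)` (`Brick.exists_FP_budget_two_pow_log_pow`, from the bricks
  of `SmoothQuasiPoly.lean` / `StackBricksArith.lean`).

Theorems only; no definition and no named fact is introduced.

## References

* C. D. Murray, R. R. Williams, *Circuit lower bounds for nondeterministic quasi-polytime: an
  easy witness lemma for NP and NQP*, Proc. 50th STOC (2018) 890–901 (ECCC TR17-188), §1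
  (`NQP = NTIME[n^{log^{O(1)} n}]`), §1.1 ("`NQP` does not have `n^{logᵏ n}`-size `ACC ∘ THR`
  circuits for every fixed `k`"), Thm. 1.3 [MurrayWilliams2018].
* R. Williams, *Nonuniform ACC circuit lower bounds*, J. ACM 61 (2014), Lemma 5.1 (pinning via
  CIRCUIT-EVAL) [Williams2014].
* S. Arora, B. Barak, *Computational Complexity: A Modern Approach*, CUP 2009, §1.3
  (time-constructible functions), §3.1 [AroraBarakCC2009].
-/

noncomputable section

namespace Literature.Computability.Complexity

open _root_.Computability Turing Filter Asymptotics Polynomial Classes CircEval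

/-! ### The §1.1 form from Theorem 1.3 alone -/

/-- **`MurrayWilliams2018_NQP_not_ACC` from Theorem 1.3 alone** (Murray–Williams 2018, §1.1:
"`NQP` does not have `ACC ∘ THR` circuits of `n^{logᵏ n}` size, for all fixed `k`", with
Thm. 1.3). Proof: if every `L ∈ NQP` had depth-`d` `AC⁰[m]` circuits of size
`c · n^{(log₂ n)ᵏ} + c` for some `(d, m, c)`, then so would `EvalLang ∈ P ⊆ NQP`
(`P_subset_NQP`), for some `(d₀, m₀)`; by pinning (`exists_level_pinned`, Williams 2014,
Lemma 5.1) every `NQP` language then has depth-`(d₀ + 1)` `AC⁰[m₀]` circuits of size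
`c' · 2^{(log₂ n)ᴷ} + c' ≤ 3c' · n^{(log₂ n)ᴷ} + 3c'` (`mul_two_pow_pow_log_add_le`); Thm. 1.3 at
`(K, d₀ + 1, m₀)` yields a language in `NTIME (n ^ (log₂ n)ᵉ) ⊆ NQP`
(`NTIME_pow_log_pow_subset_NQP`) without them. No `ACC`-SAT hypothesis is involved (compare
`MurrayWilliams2018_NQP_not_ACC_of_thm_1_2_acc`). [cite: MurrayWilliams2018, §1.1 and Thm. 1.3] -/
theorem MurrayWilliams2018_NQP_not_ACC_of_NTIME_not_depth_ACC
    (h13 : MurrayWilliams2018_NTIME_not_depth_ACC) : MurrayWilliams2018_NQP_not_ACC := by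
  intro k
  by_contra hcon
  push Not at hcon
  obtain ⟨K, hK⟩ := exists_level_pinned k
  obtain ⟨d₀, m₀, c₀, hm₀, hE⟩ := hcon EvalLang (P_subset_NQP EvalLang_mem_P)
  obtain ⟨e, -, L, hL, hnot⟩ := h13 K (d₀ + 1) m₀ hm₀
  obtain ⟨d, m, c, hm, hLc⟩ := hcon L (NTIME_pow_log_pow_subset_NQP e hL)
  obtain ⟨c', hc'⟩ := hK hE (lt_of_lt_of_le two_pos hm) hLc
  exact hnot (3 * c') (DepthSizeClass_mono le_rfl (fun _ => le_rfl)
    (fun n => mul_two_pow_pow_log_add_le c' K n) hc')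

/-! ### Unary clocks for time-computable budgets -/

open UnaryClock in
/-- **A unary clock for every time-computable budget.** If `g : ℕ → ℕ` is computable from `1ⁿ`
(to binary) within `T n` steps, some `TM2` machine maps every `x` to `⟨x, 1^{g |x|}⟩` within
`T |x| + 103 · (g |x| + |x|) + 103` steps: the pipeline `pre` (`x ↦ ⟨1^{|x|}, x⟩`), the machine
of `g` on the first component (`mapFstAux`), `post` (`⟨bin G, x⟩ ↦ ⟨x, 1^G⟩`) of
`exists_unaryClock_of_timeConstructible` (`NTIMEHierarchyClock.lean`), with the running time
kept symbolic instead of `O(g)` — so that budgets which are not time constructible in the sense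
of `IsTimeConstructible` (which asks `n ≤ g n`) still have clocks.
[cite: AroraBarakCC2009, §1.3 (time-constructible functions)] -/
theorem exists_unaryClock_of_timeComputable {g T : ℕ → ℕ}
    (hg : TimeComputable unaryEncodeNat encodeNat g T) :
    ∃ N : TM2ComputableAux Bool Bool, ∀ x : List Bool,
      N.OutputsWithin x (boolPair x (List.replicate (g x.length) true))
        (T x.length + 103 * (g x.length + x.length) + 103) := by
  obtain ⟨Mg, hMg⟩ := hg
  obtain ⟨M₁, hM₁⟩ := exists_machine_pre
  obtain ⟨M₃, hM₃⟩ := exists_machine_post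
  refine ⟨M₁.comp ((mapFstAux Mg).comp M₃), fun x => ?_⟩
  obtain ⟨n, hn0⟩ : ∃ n, x.length = n := ⟨_, rfl⟩
  rw [hn0]
  -- stage 2: the machine of `g` on the first component
  have h2 : (mapFstAux Mg).OutputsWithin (boolPair (un n) x) (boolPair (encodeNat (g n)) x)
      (T n + 3 * (encodeNat (g n)).length + 2 * (boolPair (un n) x).length + 6) := by
    have hz : Mg.OutputsWithin (boolUnpair (boolPair (un n) x)).1 (encodeNat (g n)) (T n) := by
      have := hMg n
      dsimp only at this
      rw [unaryEncodeNat_eq_un] at this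
      simpa [un] using this
    have := outputsWithin_mapFstAux Mg hz
    rwa [readRest_boolPair] at this
  have h23 := Turing.TM2ComputableAux.comp_outputsWithin _ _ h2 (hM₃ (g n) x)
  have h1 := hM₁ x
  rw [hn0] at h1
  have h := Turing.TM2ComputableAux.comp_outputsWithin _ _ h1 h23
  refine h.mono ?_
  have hlen : (encodeNat (g n)).length ≤ g n + 1 := TM2Pass.length_encodeNat_le_self (g n)
  have hp : (boolPair (un n) x).length = 2 * n + 2 + n := by simp [un, hn0]
  rw [hp, hn0]
  omega

/-! ### The budget `c · 2^{(log₂ n)ᵏ} + c` in `FP` and its clock -/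

namespace Brick

open HashBricks

/-- **An `FP` function `1ⁿ ↦ bin (c · 2^{(log₂ n)ᵏ} + c)`**: `2^{(log₂ n)ᵏ}` as a modular power
of `2` with exponent `natPowFn k ∘ qpJ` (`= bin ((log₂ n)ᵏ)`) below the modulus `qpM k`
(`= 2 · (2^{n^{k+1}})² + 1 > 2^{(log₂ n)ᵏ}`), then `· c + c` by the product and sum bricks
(`SmoothQuasiPoly.lean`, `StackBricksArith.lean`). Packaged existentially (no new definition).
[folklore] -/
theorem exists_FP_budget_two_pow_log_pow (c k : ℕ) :
    ∃ F : List Bool → List Bool, F ∈ FP ∧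
      ∀ n : ℕ, F (unaryEncodeNat n) = encodeNat (c * 2 ^ Nat.log 2 n ^ k + c) := by
  refine ⟨addFn ∘ fanoutFn (prodFn ∘ fanoutFn (fun _ => encodeNat c)
      (modExpFn ∘ fanoutFn (fun _ => encodeNat 2) (fanoutFn (natPowFn k ∘ qpJ) (qpM k))))
      (fun _ => encodeNat c), ?_, fun n => ?_⟩
  · exact comp_mem_FP addFn_mem_FP (fanoutFn_mem_FP
      (comp_mem_FP prodFn_mem_FP (fanoutFn_mem_FP (const_mem_FP _)
        (comp_mem_FP modExpFn_mem_FP (fanoutFn_mem_FP (const_mem_FP _)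
          (fanoutFn_mem_FP (comp_mem_FP (natPowFn_mem_FP k) qpJ_mem_FP) (qpM_mem_FP k))))))
      (const_mem_FP _))
  · have hm : 2 ≤ bitsToNat (encodeNat (2 * (2 ^ n ^ (k + 1) * 2 ^ n ^ (k + 1)) + 1)) := by
      rw [bitsToNat_encodeNat]; have := Nat.one_le_two_pow (n := n ^ (k + 1)); nlinarith
    have hlt : 2 ^ Nat.log 2 n ^ k < 2 * (2 ^ n ^ (k + 1) * 2 ^ n ^ (k + 1)) + 1 := by
      have h1 : Nat.log 2 n ^ k ≤ n ^ (k + 1) + 1 := by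
        rcases Nat.eq_zero_or_pos n with rfl | hn
        · rcases Nat.eq_zero_or_pos k with rfl | hk
          · simp
          · simp [Nat.log_zero_right, zero_pow hk.ne']
        · calc Nat.log 2 n ^ k ≤ n ^ k := Nat.pow_le_pow_left (Nat.log_lt_self 2 hn.ne').le k
            _ ≤ n ^ (k + 1) := Nat.pow_le_pow_right hn (Nat.le_succ k)
            _ ≤ n ^ (k + 1) + 1 := Nat.le_succ _
      have h2 : 1 ≤ 2 ^ n ^ (k + 1) := Nat.one_le_two_pow
      calc 2 ^ Nat.log 2 n ^ k ≤ 2 ^ (n ^ (k + 1) + 1) := Nat.pow_le_pow_right two_pos h1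
        _ = 2 * (2 ^ n ^ (k + 1) * 1) := by ring
        _ ≤ 2 * (2 ^ n ^ (k + 1) * 2 ^ n ^ (k + 1)) :=
            Nat.mul_le_mul_left 2 (Nat.mul_le_mul_left _ h2)
        _ < _ := Nat.lt_succ_self _
    have hmod : modExpFn (boolPair (encodeNat 2) (boolPair (encodeNat (Nat.log 2 n ^ k))
        (encodeNat (2 * (2 ^ n ^ (k + 1) * 2 ^ n ^ (k + 1)) + 1)))) =
          encodeNat (2 ^ Nat.log 2 n ^ k) := by
      rw [modExpFn_boolPair hm, bitsToNat_encodeNat, bitsToNat_encodeNat, bitsToNat_encodeNat,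
        Nat.mod_eq_of_lt hlt]
    simp only [Function.comp_apply, fanoutFn_apply, qpJ_unary, natPowFn_apply, bitsToNat_encodeNat,
      qpM_unary, hmod, prodFn_boolPair, addFn_boolPair]

end Brick

/-- `n ↦ c · 2^{(log₂ n)ᵏ} + c` is polynomial-time computable from unary input to binary output
(`Brick.exists_FP_budget_two_pow_log_pow`). [folklore] -/
theorem polyTimeComputable_budget_two_pow_log_pow (c k : ℕ) :
    PolyTimeComputable unaryEncodeNat encodeNat (fun n : ℕ => c * 2 ^ Nat.log 2 n ^ k + c) := by
  obtain ⟨F, hF, hFn⟩ := Brick.exists_FP_budget_two_pow_log_pow c k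
  exact hF.of_encode (g := unaryEncodeNat) (fun _ => rfl) fun n => hFn n

/-! ### The two presentations of `NQP` -/

/-- **`NTIME (2 ^ (log₂ n)ᵏ) ⊆ NTIME (n ^ (log₂ n)^(k+1))`.** The levels of the tree's
`NQP = ⋃ₖ NTIME (2 ^ (log₂ n)ᵏ)` lie inside the levels `NTIME (n ^ (log₂ n)ᵉ)` in which
Murray–Williams' Theorem 1.3 (`MurrayWilliams2018_NTIME_not_depth_ACC`) is stated. Pointwise
`2^{(log₂ n)ᵏ} ≤ 3 n^{(log₂ n)ᵏ} + 3` (`mul_two_pow_pow_log_add_le`), but the level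
`2 ^ (log₂ n)ᵏ` is not time constructible in the tree's sense for `k ≤ 1` (`n ≤ t n` fails), so
the inclusion is obtained by transporting verifiers along a clock (`NTIME_subset_of_clocks`,
`NVerifier.exists_transport`): the budget `c · 2^{(log₂ n)ᵏ} + c` is computed in polynomial time
(`polyTimeComputable_budget_two_pow_log_pow`) and written in unary
(`exists_unaryClock_of_timeComputable`), all within `O(n ^ (log₂ n)^(k+1))` steps (every
polynomial is `≤ C n^{log₂ n} + C`, `natPoly_exists_eval_le_pow_log`).
[cite: MurrayWilliams2018, §1 (`NQP = NTIME[n^{log^{O(1)} n}]`)] -/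
theorem NTIME_two_pow_log_pow_subset_NTIME_pow_log_pow_succ (k : ℕ) :
    NTIME (fun n => 2 ^ Nat.log 2 n ^ k) ⊆ NTIME (fun n => n ^ Nat.log 2 n ^ (k + 1)) := by
  refine NTIME_subset_of_clocks fun c _ => ?_
  obtain ⟨p, hp⟩ := polyTimeComputable_budget_two_pow_log_pow c k
  obtain ⟨N, hN⟩ := exists_unaryClock_of_timeComputable hp
  obtain ⟨C, hC⟩ := natPoly_exists_eval_le_pow_log p
  -- pointwise bounds against the target level `n ^ (log₂ n)^(k+1)`
  have hg : ∀ n : ℕ, c * 2 ^ Nat.log 2 n ^ k + c ≤ 3 * c * n ^ Nat.log 2 n ^ (k + 1) + 3 * c :=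
    fun n => (mul_two_pow_pow_log_add_le c k n).trans (Nat.add_le_add_right
      (Nat.mul_le_mul_left _ (pow_log_pow_exp_mono (Nat.le_succ k) n)) _)
  have hpoly : ∀ n : ℕ, p.eval n ≤ C * n ^ Nat.log 2 n ^ (k + 1) + C := fun n => by
    have h := pow_log_pow_exp_mono (show 1 ≤ k + 1 by omega) n
    rw [pow_one] at h
    exact (hC n).trans (Nat.add_le_add_right (Nat.mul_le_mul_left _ h) _)
  have hid : ∀ n : ℕ, n ≤ n ^ Nat.log 2 n ^ (k + 1) := fun n =>
    (ExpPad.sizes_le_pow_pow_log (k + 1) n).1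
  refine ⟨N, C + 309 * c + 103, fun x => (hN x).mono ?_, fun n => ?_, fun n => ?_⟩
  · set n := x.length
    calc p.eval n + 103 * (c * 2 ^ Nat.log 2 n ^ k + c + n) + 103
        ≤ (C * n ^ Nat.log 2 n ^ (k + 1) + C) +
            103 * ((3 * c * n ^ Nat.log 2 n ^ (k + 1) + 3 * c) + n ^ Nat.log 2 n ^ (k + 1)) +
            103 :=
          Nat.add_le_add_right (Nat.add_le_add (hpoly n)
            (Nat.mul_le_mul_left 103 (Nat.add_le_add (hg n) (hid n)))) 103
      _ = (C + 309 * c + 103) * n ^ Nat.log 2 n ^ (k + 1) + (C + 309 * c + 103) := by ring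
  · calc c * 2 ^ Nat.log 2 n ^ k + c ≤ 3 * c * n ^ Nat.log 2 n ^ (k + 1) + 3 * c := hg n
      _ ≤ (C + 309 * c + 103) * n ^ Nat.log 2 n ^ (k + 1) + (C + 309 * c + 103) :=
          Nat.add_le_add (Nat.mul_le_mul_right _ (by omega)) (by omega)
  · calc n ≤ n ^ Nat.log 2 n ^ (k + 1) := hid n
      _ ≤ (C + 309 * c + 103) * n ^ Nat.log 2 n ^ (k + 1) + (C + 309 * c + 103) :=
          (Nat.le_mul_of_pos_left _ (by omega)).trans (Nat.le_add_right _ _)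

/-- **`NQP ⊆ ⋃ₑ NTIME (n ^ (log₂ n)^(e+1))`**: the tree's `NQP` inside the union of the levels
of Theorem 1.3. [cite: MurrayWilliams2018, §1] -/
theorem NQP_subset_iUnion_NTIME_pow_log_pow :
    NQP ⊆ ⋃ e : ℕ, NTIME (fun n => n ^ Nat.log 2 n ^ (e + 1)) := by
  intro L hL
  obtain ⟨k, hk⟩ := mem_NQP_iff.1 hL
  exact Set.mem_iUnion.2 ⟨k, NTIME_two_pow_log_pow_subset_NTIME_pow_log_pow_succ k hk⟩

/-- **The two presentations of nondeterministic quasi-polynomial time agree**: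
`⋃ₖ NTIME (2 ^ (log₂ n)ᵏ) = ⋃ₑ NTIME (n ^ (log₂ n)^(e+1))` (Murray–Williams 2018, §1:
"`NQP = NTIME[n^{log^{O(1)} n}]`"; the docstring of `NQP` in `CircuitLowerBounds.lean` asserts
the agreement informally). The inclusion `⊇` is `NTIME_pow_log_pow_subset_NQP`
(`QuasiPolyClock.lean`), `⊆` is `NQP_subset_iUnion_NTIME_pow_log_pow`.
[cite: MurrayWilliams2018, §1] -/
theorem NQP_eq_iUnion_NTIME_pow_log_pow :
    NQP = ⋃ e : ℕ, NTIME (fun n => n ^ Nat.log 2 n ^ (e + 1)) :=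
  Set.Subset.antisymm NQP_subset_iUnion_NTIME_pow_log_pow
    (Set.iUnion_subset fun e => NTIME_pow_log_pow_subset_NQP (e + 1))

/-- Membership form: `L ∈ NQP ↔ ∃ e ≥ 1, L ∈ NTIME (n ^ (log₂ n)ᵉ)` — the shape of the time
bound in `MurrayWilliams2018_NTIME_not_depth_ACC`. [cite: MurrayWilliams2018, §1] -/
theorem mem_NQP_iff_exists_mem_NTIME_pow_log_pow {L : Language Bool} :
    L ∈ NQP ↔ ∃ e : ℕ, 1 ≤ e ∧ L ∈ NTIME (fun n => n ^ Nat.log 2 n ^ e) := by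
  constructor
  · intro hL
    obtain ⟨e, he⟩ := Set.mem_iUnion.1 (NQP_subset_iUnion_NTIME_pow_log_pow hL)
    exact ⟨e + 1, Nat.succ_pos e, he⟩
  · rintro ⟨e, -, he⟩
    exact NTIME_pow_log_pow_subset_NQP e he

/-! ### Theorem 1.3 from the §1.1 form: the two named facts are equivalent -/

/-- **Theorem 1.3 (`MurrayWilliams2018_NTIME_not_depth_ACC`) from the §1.1 form
(`MurrayWilliams2018_NQP_not_ACC`)**: the single `NQP` language without
`c · n^{(log₂ n)ᵏ} + c`-size depth-`d` `AC⁰[m]` circuits for any `(d, m, c)` lies in some level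
`NTIME (n ^ (log₂ n)ᵉ)`, `e ≥ 1` (`mem_NQP_iff_exists_mem_NTIME_pow_log_pow`), and serves every
`(k, d, m)`. [cite: MurrayWilliams2018, §1.1 and Thm. 1.3] -/
theorem MurrayWilliams2018_NTIME_not_depth_ACC_of_NQP_not_ACC
    (h : MurrayWilliams2018_NQP_not_ACC) : MurrayWilliams2018_NTIME_not_depth_ACC := by
  intro k d m hm
  obtain ⟨L, hL, hnot⟩ := h k
  obtain ⟨e, he, hLe⟩ := mem_NQP_iff_exists_mem_NTIME_pow_log_pow.1 hL
  exact ⟨e, he, L, hLe, fun c => hnot d m c hm⟩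

/-- **The two Murray–Williams named facts of `CircuitLowerBounds.lean` are equivalent**:
`MurrayWilliams2018_NQP_not_ACC ↔ MurrayWilliams2018_NTIME_not_depth_ACC` — the §1.1
single-language form and the printed `(k, d, m)`-indexed Theorem 1.3 (threshold-free). A
discharge of either discharges the other (and the headline `MurrayWilliams2018_NQP_not_subset_ACC0`:
`MurrayWilliams2018_NQP_not_ACC.not_subset_ACC0`, or directly
`MurrayWilliams2018_NQP_not_subset_ACC0_of_thm_1_3` of `MurrayWilliams2018NQP.lean`).
[cite: MurrayWilliams2018, §1.1 and Thm. 1.3] -/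
theorem MurrayWilliams2018_NQP_not_ACC_iff_NTIME_not_depth_ACC :
    MurrayWilliams2018_NQP_not_ACC ↔ MurrayWilliams2018_NTIME_not_depth_ACC :=
  ⟨MurrayWilliams2018_NTIME_not_depth_ACC_of_NQP_not_ACC,
    MurrayWilliams2018_NQP_not_ACC_of_NTIME_not_depth_ACC⟩

end Literature.Computability.Complexity

end
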